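import Literature.MathematicalPhysics.QuantumFieldTheory.Balaban1983to89.T3PolyakovVariance
import HarnessLib

/-!
# `Balaban1983to89.T3TailTransferLower` — rung R3: the MULTIPLICATIVE lower transfer under K1 ∧ K2 (tilt radii enter only through
# `e^{−2Σr}`), and NT3 with smallness demanded of the LARGE-FIELD MASSES ONLY

CITATION HEADER (lean-in-tree rule).  Cell `ym3-torus` (HUMAN RULING D-0037, YM ladder rung R3), seat `ym3-torus-p2` gen 6 (HOME/IR-NODE.md §12).
Sources: C. King, Commun. Math. Phys. **102** (1986) 649 [King1986] Thm 3.4, (3.9)–(3.13) pp. 656–657 (two cut-offs' effective densities agree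
up to `e^{±O(L^{-γk})}` off a large-field event of small mass; the Cauchy device); C. Borgs, E. Seiler, Commun. Math. Phys. **91** (1983) 329
[BorgsSeiler1983] §III.1 (III.23) p. 347 (the margin `⟨W_P²⟩ ≥ 1/4`, tree `PolyakovDiagonalBound` / `T3PolyakovVariance`); S. Chatterjee in
Friz et al. (eds.) 2019 [Chatterjee2019YMProbabilists] §6 p. 19 (non-triviality of Wilson loop variables in a `d ≥ 3` continuum limit is open).

THE POINT.  `T3TailTransfer` transports a lower bound from one cutoff to all later ones ADDITIVELY, at the price `Σ(8r + 4w + 2w')` — so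
`T3PolyakovVariance.uniformVariance_polyakov_of_unitTiltTail` needs the TILT RADII `r_K` (the K1 crux, `sup|h_K|`, extensive in the volume)
to have a small sum.  For a NON-NEGATIVE observable the tilt acts MULTIPLICATIVELY: if `ν_g = C e^{h} μ_g` with `|h| ≤ r`, the normalisation
pins `C ≥ (1 − ν_b(X)) e^{−r}`, whence for measurable `0 ≤ W ≤ 1`
`∫ W dν ≥ e^{−2r} ∫ W dμ − (μ_b(X) + ν_b(X))` (`integral_ge_of_tiltSplit`).  Iterating along `UnitTiltTail F ℰ γ r w w'`:
**`∫ W dμ_K ≥ e^{−2 Σ_{i≥K₀} r_i} ∫ W dμ_{K₀} − Σ_{i≥K₀} (w_i + w'_i)`** for all `K ≥ K₀` (`le_integral_unitLaw_mul`) — the radii need only be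
SUMMABLE (exactly what K1 `UnitTiltAt` delivers); smallness is asked only of the large-field masses `w, w'` (K2's currency, super-polynomially
small in the coupling: [Balaban1985UV3] (71), tree `T3BareTailProfile.bareTailAt` for the bare height).  With the margin `⟨W̄_P W̄_P⟩₀ ≥ 1/4`:
**`uniformVariance_polyakov_of_smallMass`** — `UnitTiltTail` + `c + Σ(w + w') ≤ e^{−2Σr}/4` ⇒ `UniformVariance (F.scheme ℰ γ) (polyakov 0 x) c`
(`SU(2)`, measurable `ℰ`, `γ ≥ 0`, base point in the plane `t = 0`); `continuumYM3Torus_nontrivial_of_smallMass`, `limitPointsNontrivial_of_smallMass`.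

WHAT THIS IS NOT.  Not NT3 unconditionally: `Σr` is still extensive (`e^{−2Σr}` small in large volume at fixed `γ`), so the mass condition is
a per-torus threshold `γ ≤ γ₂(L, m)` — but now on the side (K2) where explicit super-exponential profiles are printed/landed, not on the tilt.
-/

noncomputable section

open MeasureTheory Filter Topology
open Literature.MathematicalPhysics.QuantumFieldTheory.Balaban1983to89.T4Continuum
open Literature.MathematicalPhysics.QuantumFieldTheory.Balaban1983to89.T3ContinuumYM3Torus
open Literature.MathematicalPhysics.QuantumFieldTheory.Balaban1983to89.T3ThresholdRemoval
open Literature.MathematicalPhysics.QuantumFieldTheory.Balaban1983to89.T3UnitScaleTilt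
open Literature.MathematicalPhysics.QuantumFieldTheory.Balaban1983to89.T3PolyakovVariance

namespace Literature.MathematicalPhysics.QuantumFieldTheory.Balaban1983to89.T3TailTransferLower

/-! ## 1. One step, pure measure theory: the multiplicative lower bound for a tilt split -/

section Measure

variable {X : Type*} [MeasurableSpace X]

/-- **LOWER FOUR-MEASURE LEMMA FOR NON-NEGATIVE OBSERVABLES.**  Two probability laws split as good + bad, `μ_g + μ_b` and `ν_g + ν_b`,
good parts tilt-related with radius `r` (`ν_g = C e^{h} μ_g`, `|h| ≤ r`, `C ≥ 0` free): for every measurable `0 ≤ W ≤ 1`,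
`e^{−2r} ∫ W d(μ_g + μ_b) − (μ_b(X) + ν_b(X)) ≤ ∫ W d(ν_g + ν_b)` — normalisation pins `C e^{r} ≥ ν_g(X) = 1 − ν_b(X)`, and
`∫ W dν_g = ∫ C e^{h} W dμ_g ≥ C e^{−r} ∫ W dμ_g`.  The radius enters through `e^{−2r}` only. [cite: King1986, Thm 3.4 (3.9) p.656] -/
theorem integral_ge_of_tiltSplit {μg μb νg νb : Measure X} [IsProbabilityMeasure (μg + μb)] [IsProbabilityMeasure (νg + νb)]
    {r : ℝ} (ht : IsTilt μg νg r) {W : X → ℝ} (hWm : Measurable W) (hW0 : ∀ x, 0 ≤ W x) (hW1 : ∀ x, W x ≤ 1) :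
    Real.exp (-2 * r) * (∫ x, W x ∂(μg + μb)) - (μb.real Set.univ + νb.real Set.univ) ≤ ∫ x, W x ∂(νg + νb) := by
  obtain ⟨hr0, h, C, hhm, hC, hh, htilt⟩ := ht
  haveI : IsFiniteMeasure μg := isFiniteMeasure_of_le (μg + μb) (Measure.le_add_right le_rfl)
  haveI : IsFiniteMeasure μb := isFiniteMeasure_of_le (μg + μb) (Measure.le_add_left le_rfl)
  haveI : IsFiniteMeasure νg := isFiniteMeasure_of_le (νg + νb) (Measure.le_add_right le_rfl)
  haveI : IsFiniteMeasure νb := isFiniteMeasure_of_le (νg + νb) (Measure.le_add_left le_rfl)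
  have hWabs : ∀ x, |W x| ≤ 1 := fun x => abs_le.mpr ⟨by linarith [hW0 x], hW1 x⟩
  have hint : ∀ (κ : Measure X) [IsFiniteMeasure κ] {f : X → ℝ} (B : ℝ), Measurable f → (∀ x, |f x| ≤ B) →
      Integrable f κ := fun κ _ f B hf hB =>
    (integrable_const B).mono' hf.aestronglyMeasurable (ae_of_all _ fun x => by rw [Real.norm_eq_abs]; exact hB x)
  have hWi : ∀ (κ : Measure X) [IsFiniteMeasure κ], Integrable W κ := fun κ _ => hint κ 1 hWm hWabs
  -- masses
  have hMsum : μg.real Set.univ + μb.real Set.univ = 1 := by rw [← measureReal_add_apply, probReal_univ]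
  have hNsum : νg.real Set.univ + νb.real Set.univ = 1 := by rw [← measureReal_add_apply, probReal_univ]
  have hMg0 : 0 ≤ μg.real Set.univ := measureReal_nonneg
  have hMb0 : 0 ≤ μb.real Set.univ := measureReal_nonneg
  have hNg0 : 0 ≤ νg.real Set.univ := measureReal_nonneg
  have hNb0 : 0 ≤ νb.real Set.univ := measureReal_nonneg
  -- the density `g = C e^{h}` and its constant bounds
  have hg_meas : Measurable fun x => C * Real.exp (h x) := (Real.measurable_exp.comp hhm).const_mul C
  have hg0 : ∀ x, 0 ≤ C * Real.exp (h x) := fun x => mul_nonneg hC (Real.exp_pos _).le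
  have hga : ∀ x, C * Real.exp (-r) ≤ C * Real.exp (h x) := fun x =>
    mul_le_mul_of_nonneg_left (Real.exp_le_exp.mpr (abs_le.mp (hh x)).1) hC
  have hgb : ∀ x, C * Real.exp (h x) ≤ C * Real.exp r := fun x =>
    mul_le_mul_of_nonneg_left (Real.exp_le_exp.mpr (abs_le.mp (hh x)).2) hC
  have hgi : Integrable (fun x => C * Real.exp (h x)) μg :=
    hint μg (C * Real.exp r) hg_meas (fun x => by rw [abs_of_nonneg (hg0 x)]; exact hgb x)
  -- normalisation: `ν_g(X) = ∫ g dμ_g ≤ C e^{r} μ_g(X) ≤ C e^{r}`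
  have hN_int : νg.real Set.univ = ∫ x, C * Real.exp (h x) ∂μg := by
    have h1 : ∫ _x, (1 : ℝ) ∂νg = νg.real Set.univ := by rw [integral_const, smul_eq_mul, mul_one]
    rw [← h1, htilt, T4VarianceMatching.integral_withDensity_ofReal_mul hg_meas hg0]
    simp only [mul_one]
  have hbM : νg.real Set.univ ≤ C * Real.exp r := by
    have h1 := integral_mono hgi (integrable_const (C * Real.exp r)) hgb
    rw [integral_const, smul_eq_mul] at h1
    rw [hN_int]
    have h2 : μg.real Set.univ * (C * Real.exp r) ≤ 1 * (C * Real.exp r) :=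
      mul_le_mul_of_nonneg_right (by linarith) (mul_nonneg hC (Real.exp_pos _).le)
    linarith
  -- the good part: `∫ W dν_g ≥ C e^{-r} ∫ W dμ_g`
  have hIg0 : 0 ≤ ∫ x, W x ∂μg := integral_nonneg hW0
  have hIg1 : ∫ x, W x ∂μg ≤ 1 := by
    have h1 := integral_mono (hWi μg) (integrable_const (1 : ℝ)) hW1
    rw [integral_const, smul_eq_mul, mul_one] at h1
    linarith
  have hgood : C * Real.exp (-r) * ∫ x, W x ∂μg ≤ ∫ x, W x ∂νg := by
    have hgWi : Integrable (fun x => C * Real.exp (h x) * W x) μg :=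
      hint μg (C * Real.exp r) (hg_meas.mul hWm) fun x => by
        rw [abs_mul, abs_of_nonneg (hg0 x)]
        calc C * Real.exp (h x) * |W x| ≤ C * Real.exp r * 1 :=
              mul_le_mul (hgb x) (hWabs x) (abs_nonneg _) (mul_nonneg hC (Real.exp_pos _).le)
          _ = C * Real.exp r := mul_one _
    rw [htilt, T4VarianceMatching.integral_withDensity_ofReal_mul hg_meas hg0 W, ← integral_const_mul]
    exact integral_mono ((hWi μg).const_mul _) hgWi fun x => mul_le_mul_of_nonneg_right (hga x) (hW0 x)
  -- the bad parts
  have hνb : 0 ≤ ∫ x, W x ∂νb := integral_nonneg hW0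
  have hμb : ∫ x, W x ∂μb ≤ μb.real Set.univ := by
    have h1 := integral_mono (hWi μb) (integrable_const (1 : ℝ)) hW1
    rwa [integral_const, smul_eq_mul, mul_one] at h1
  -- assemble: `∫W dν ≥ C e^{-r} I_g ≥ (1 − ν_b) e^{-2r} I_g ≥ e^{-2r} I_g − ν_b ≥ e^{-2r}(I − μ_b) − ν_b`
  have hexp2 : Real.exp (-2 * r) = Real.exp (-r) * Real.exp (-r) := by rw [← Real.exp_add]; ring_nf
  have he1 : Real.exp (-2 * r) ≤ 1 := Real.exp_le_one_iff.mpr (by linarith)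
  have he0 : 0 ≤ Real.exp (-r) := (Real.exp_pos _).le
  have hCge : (1 - νb.real Set.univ) * Real.exp (-r) ≤ C := by
    have h1 : (1 - νb.real Set.univ) ≤ C * Real.exp r := by linarith
    have h2 := mul_le_mul_of_nonneg_right h1 he0
    rwa [mul_assoc, ← Real.exp_add, add_neg_cancel, Real.exp_zero, mul_one] at h2
  have hstep : (1 - νb.real Set.univ) * Real.exp (-2 * r) * ∫ x, W x ∂μg ≤ C * Real.exp (-r) * ∫ x, W x ∂μg := by
    rw [hexp2, ← mul_assoc]
    exact mul_le_mul_of_nonneg_right (mul_le_mul_of_nonneg_right hCge he0) hIg0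
  rw [integral_add_measure (hWi νg) (hWi νb), integral_add_measure (hWi μg) (hWi μb)]
  have hkey : Real.exp (-2 * r) * ∫ x, W x ∂μg - νb.real Set.univ ≤
      (1 - νb.real Set.univ) * Real.exp (-2 * r) * ∫ x, W x ∂μg := by
    have : νb.real Set.univ * (Real.exp (-2 * r) * ∫ x, W x ∂μg) ≤ νb.real Set.univ * 1 :=
      mul_le_mul_of_nonneg_left (by nlinarith [(Real.exp_pos (-2 * r)).le]) hNb0
    nlinarith
  nlinarith [mul_le_mul_of_nonneg_left hμb (Real.exp_pos (-2 * r)).le]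

end Measure

/-! ## 2. Along `UnitTiltTail`: one step, finitely many steps, the whole tail -/

section UnitLaw

variable {F : T3Family} {G : Type*} [GaugeGroup G] [MeasurableSpace G] [HaarData G] [RegularGaugeGroup G]
  {ℰ : LoopAverage G} {γ : ℝ} {r w w' : ℕ → ℝ}

/-- **ONE STEP**: under `UnitTiltTail F ℰ γ r w w'`, every measurable unit-field observable `0 ≤ W ≤ 1` has
`e^{−2r_K} ∫ W dμ_K − (w_K + w'_K) ≤ ∫ W dμ_{K+1}`. [cite: King1986, Thm 3.4 (3.9)-(3.10) p.656] -/
theorem le_integral_unitLaw_succ_mul (hE : ℰ.MeasurableE) (hγ : 0 ≤ γ) (h : UnitTiltTail F ℰ γ r w w')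
    {W : GaugeField (F.P 0) 0 G → ℝ} (hWm : Measurable W) (hW0 : ∀ u, 0 ≤ W u) (hW1 : ∀ u, W u ≤ 1) (K : ℕ) :
    Real.exp (-2 * r K) * (∫ u, W u ∂F.unitLaw ℰ hE γ K) - (w K + w' K) ≤ ∫ u, W u ∂F.unitLaw ℰ hE γ (K + 1) := by
  obtain ⟨Gd₀, Gd₁, hGd₀, hGd₁, htilt, htail⟩ := h
  have hP : ∀ (K : ℕ) (S : Set (GaugeField (F.P K) 0 G)), MeasurableSet S → IsProbabilityMeasure
      (Measure.map (unitA F ℰ K) ((gibbsK F ℰ γ K).restrict S) +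
        Measure.map (unitA F ℰ K) ((gibbsK F ℰ γ K).restrict Sᶜ)) := by
    intro K S hS
    rw [← unitLaw_eq_map_restrict_add hE K hS]
    exact isProbabilityMeasure_unitLaw hE hγ K
  haveI := hP K (Gd₀ K) (hGd₀ K)
  haveI := hP (K + 1) (Gd₁ K) (hGd₁ K)
  rw [unitLaw_eq_map_restrict_add hE (K + 1) (hGd₁ K), unitLaw_eq_map_restrict_add hE K (hGd₀ K)]
  have h1 := integral_ge_of_tiltSplit (μb := Measure.map (unitA F ℰ K) ((gibbsK F ℰ γ K).restrict (Gd₀ K)ᶜ))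
    (νb := Measure.map (unitA F ℰ (K + 1)) ((gibbsK F ℰ γ (K + 1)).restrict (Gd₁ K)ᶜ)) (htilt K) hWm hW0 hW1
  rw [real_map_restrict_univ hE, real_map_restrict_univ hE] at h1
  linarith [(htail K).1, (htail K).2]

/-- **FINITELY MANY STEPS**: `e^{−2 Σ_{i<d} r(K₀+i)} ∫ W dμ_{K₀} − Σ_{i<d} (w + w')(K₀+i) ≤ ∫ W dμ_{K₀+d}` (`r, w, w' ≥ 0`).
[cite: King1986, Thm 3.4 (3.13) p.657] -/
theorem le_integral_unitLaw_add_mul (hE : ℰ.MeasurableE) (hγ : 0 ≤ γ) (h : UnitTiltTail F ℰ γ r w w')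
    (hr0 : ∀ K, 0 ≤ r K) (hw0 : ∀ K, 0 ≤ w K) (hw0' : ∀ K, 0 ≤ w' K) {W : GaugeField (F.P 0) 0 G → ℝ}
    (hWm : Measurable W) (hW0 : ∀ u, 0 ≤ W u) (hW1 : ∀ u, W u ≤ 1) (K₀ : ℕ) :
    ∀ d : ℕ, Real.exp (-2 * ∑ i ∈ Finset.range d, r (K₀ + i)) * (∫ u, W u ∂F.unitLaw ℰ hE γ K₀) -
        ∑ i ∈ Finset.range d, (w (K₀ + i) + w' (K₀ + i)) ≤ ∫ u, W u ∂F.unitLaw ℰ hE γ (K₀ + d)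
  | 0 => by simp
  | d + 1 => by
    have ih := le_integral_unitLaw_add_mul hE hγ h hr0 hw0 hw0' hWm hW0 hW1 K₀ d
    have hstep := le_integral_unitLaw_succ_mul hE hγ h hWm hW0 hW1 (K₀ + d)
    rw [Finset.sum_range_succ, Finset.sum_range_succ, show K₀ + (d + 1) = K₀ + d + 1 by omega]
    haveI := isProbabilityMeasure_unitLaw (F := F) hE hγ K₀
    have ha0 : 0 ≤ ∫ u, W u ∂F.unitLaw ℰ hE γ K₀ := integral_nonneg hW0
    have hE1 : Real.exp (-2 * r (K₀ + d)) ≤ 1 := Real.exp_le_one_iff.mpr (by linarith [hr0 (K₀ + d)])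
    have hE0 : 0 ≤ Real.exp (-2 * r (K₀ + d)) := (Real.exp_pos _).le
    have hT0 : 0 ≤ ∑ i ∈ Finset.range d, (w (K₀ + i) + w' (K₀ + i)) :=
      Finset.sum_nonneg fun i _ => add_nonneg (hw0 _) (hw0' _)
    have hexp : Real.exp (-2 * (∑ i ∈ Finset.range d, r (K₀ + i) + r (K₀ + d))) =
        Real.exp (-2 * r (K₀ + d)) * Real.exp (-2 * ∑ i ∈ Finset.range d, r (K₀ + i)) := by
      rw [← Real.exp_add]; ring_nf
    -- multiply the induction hypothesis by `e^{-2 r_{K₀+d}} ∈ [0, 1]`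
    have h2 := mul_le_mul_of_nonneg_left ih hE0
    rw [hexp]
    nlinarith [mul_le_mul_of_nonneg_right hE1 hT0,
      mul_nonneg hE0 (mul_nonneg (Real.exp_pos (-2 * ∑ i ∈ Finset.range d, r (K₀ + i))).le ha0)]

/-- **THE WHOLE TAIL — THE MULTIPLICATIVE LOWER TRANSFER**: under `UnitTiltTail F ℰ γ r w w'` with summable non-negative rates,
every measurable `0 ≤ W ≤ 1` satisfies, for all `K ≥ K₀`,
`e^{−2 Σ_{i≥0} r(K₀+i)} · ∫ W dμ_{K₀} − Σ_{i≥0} (w(K₀+i) + w'(K₀+i)) ≤ ∫ W dμ_K`: the tilt radii need only be summable, the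
large-field masses enter additively. [cite: King1986, Thm 3.4 (3.13) p.657] -/
theorem le_integral_unitLaw_mul (hE : ℰ.MeasurableE) (hγ : 0 ≤ γ) (h : UnitTiltTail F ℰ γ r w w') (hr : Summable r)
    (hw : Summable w) (hw' : Summable w') (hr0 : ∀ K, 0 ≤ r K) (hw0 : ∀ K, 0 ≤ w K) (hw0' : ∀ K, 0 ≤ w' K)
    {W : GaugeField (F.P 0) 0 G → ℝ} (hWm : Measurable W) (hW0 : ∀ u, 0 ≤ W u) (hW1 : ∀ u, W u ≤ 1) (K₀ : ℕ) :
    ∀ K, K₀ ≤ K → Real.exp (-2 * ∑' i, r (K₀ + i)) * (∫ u, W u ∂F.unitLaw ℰ hE γ K₀) -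
      ∑' i, (w (K₀ + i) + w' (K₀ + i)) ≤ ∫ u, W u ∂F.unitLaw ℰ hE γ K := by
  intro K hK
  obtain ⟨d, rfl⟩ := Nat.exists_eq_add_of_le hK
  have hfin := le_integral_unitLaw_add_mul hE hγ h hr0 hw0 hw0' hWm hW0 hW1 K₀ d
  have hr' : Summable fun i => r (K₀ + i) :=
    ((summable_nat_add_iff K₀).mpr hr).congr fun i => by simp only [add_comm]
  have hww' : Summable fun i => w (K₀ + i) + w' (K₀ + i) :=
    (((summable_nat_add_iff K₀).mpr hw).add ((summable_nat_add_iff K₀).mpr hw')).congr fun i => by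
      simp only [add_comm]
  have h1 : ∑ i ∈ Finset.range d, r (K₀ + i) ≤ ∑' i, r (K₀ + i) := hr'.sum_le_tsum _ fun i _ => hr0 _
  have h2 : ∑ i ∈ Finset.range d, (w (K₀ + i) + w' (K₀ + i)) ≤ ∑' i, (w (K₀ + i) + w' (K₀ + i)) :=
    hww'.sum_le_tsum _ fun i _ => add_nonneg (hw0 _) (hw0' _)
  haveI := isProbabilityMeasure_unitLaw (F := F) hE hγ K₀
  have ha0 : 0 ≤ ∫ u, W u ∂F.unitLaw ℰ hE γ K₀ := integral_nonneg hW0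
  have h3 : Real.exp (-2 * ∑' i, r (K₀ + i)) ≤ Real.exp (-2 * ∑ i ∈ Finset.range d, r (K₀ + i)) :=
    Real.exp_le_exp.mpr (by linarith)
  nlinarith [mul_le_mul_of_nonneg_right h3 ha0]

end UnitLaw

/-! ## 3. NT3 with smallness on the large-field masses only (`SU(2)`) -/

section SU2

variable {F : T3Family} {ℰ : LoopAverage (Matrix.specialUnitaryGroup (Fin 2) ℂ)} {γ : ℝ} {r w w' : ℕ → ℝ}

/-- The unit-field observable `W̄_P · W̄_P` of the Polyakov label lies in `[0, 1]` and is measurable. [cite: Balaban1987RG1, (0.2)/(0.4) p.252] -/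
private theorem pairObs_props (x : F.USite) :
    Measurable (fun u : GaugeField (F.P 0) 0 (Matrix.specialUnitaryGroup (Fin 2) ℂ) =>
        ([ULoop3.polyakov 0 x, ULoop3.polyakov 0 x].map fun C => loopAt u (C.1.atLevel 0)).prod) ∧
      (∀ u : GaugeField (F.P 0) 0 (Matrix.specialUnitaryGroup (Fin 2) ℂ),
        0 ≤ ([ULoop3.polyakov 0 x, ULoop3.polyakov 0 x].map fun C => loopAt u (C.1.atLevel 0)).prod) ∧
      ∀ u : GaugeField (F.P 0) 0 (Matrix.specialUnitaryGroup (Fin 2) ℂ),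
        ([ULoop3.polyakov 0 x, ULoop3.polyakov 0 x].map fun C => loopAt u (C.1.atLevel 0)).prod ≤ 1 := by
  simp only [List.map_cons, List.map_nil, List.prod_cons, List.prod_nil, mul_one]
  refine ⟨(measurable_loopAt _).mul (measurable_loopAt _), fun u => mul_self_nonneg _, fun u => ?_⟩
  have h1 := abs_loopAt_le_one u ((ULoop3.polyakov (F := F) 0 x).1.atLevel 0)
  nlinarith [abs_nonneg (loopAt u ((ULoop3.polyakov (F := F) 0 x).1.atLevel 0)),
    abs_mul_abs_self (loopAt u ((ULoop3.polyakov (F := F) 0 x).1.atLevel 0))]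

/-- **`⟨W̄_P W̄_P⟩_K ≥ e^{−2Σr}/4 − Σ(w + w')` AT EVERY `K`** under `UnitTiltTail F ℰ γ r w w'` (summable non-negative rates), for the
Polyakov label through a base point in the plane `t = 0`: the multiplicative transfer of the margin `⟨W̄_P W̄_P⟩₀ ≥ 1/4`. [cite: BorgsSeiler1983, §III.1 (III.23) p.347] -/
theorem expectAt_polyakov_pair_ge_mul (hE : ℰ.MeasurableE) (hγ : 0 ≤ γ) (h : UnitTiltTail F ℰ γ r w w') (hr : Summable r)
    (hw : Summable w) (hw' : Summable w') (hr0 : ∀ K, 0 ≤ r K) (hw0 : ∀ K, 0 ≤ w K) (hw0' : ∀ K, 0 ≤ w' K) {x : F.USite}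
    (hx : x 0 = 0) (K : ℕ) :
    Real.exp (-2 * ∑' i, r i) / 4 - ∑' i, (w i + w' i) ≤ (F.scheme ℰ γ).expectAt K [ULoop3.polyakov 0 x, ULoop3.polyakov 0 x] := by
  obtain ⟨hWm, hW0, hW1⟩ := pairObs_props (F := F) x
  have h0 := expectAt_zero_polyakov_pair_ge F ℰ hγ hx
  rw [expectAt_eq_integral_unitLaw hE hγ 0] at h0
  have h1 := le_integral_unitLaw_mul hE hγ h hr hw hw' hr0 hw0 hw0' hWm hW0 hW1 0 K (Nat.zero_le K)
  simp only [zero_add] at h1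
  rw [expectAt_eq_integral_unitLaw hE hγ K]
  nlinarith [(Real.exp_pos (-2 * ∑' i, r i)).le]

/-- **NT3 WITH SMALLNESS ON THE LARGE-FIELD MASSES ONLY.**  `SU(2)`, measurable `ℰ`, `γ ≥ 0`: if `UnitTiltTail F ℰ γ r w w'` holds with
summable non-negative rates and `c + Σ_i (wᵢ + w'ᵢ) ≤ e^{−2 Σ_i rᵢ}/4`, `0 < c`, then `UniformVariance (F.scheme ℰ γ) (polyakov 0 x) c` for
every base point with `x 0 = 0` — the tilt radii (K1) are only asked to be summable; the super-polynomially small history tails (K2) carry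
the smallness. [cite: Chatterjee2019YMProbabilists, §6 p.19] -/
theorem uniformVariance_polyakov_of_smallMass (hE : ℰ.MeasurableE) (hγ : 0 ≤ γ) (h : UnitTiltTail F ℰ γ r w w')
    (hr : Summable r) (hw : Summable w) (hw' : Summable w') (hr0 : ∀ K, 0 ≤ r K) (hw0 : ∀ K, 0 ≤ w K) (hw0' : ∀ K, 0 ≤ w' K)
    {x : F.USite} (hx : x 0 = 0) {c : ℝ} (hc : 0 < c)
    (hsmall : c + ∑' i, (w i + w' i) ≤ Real.exp (-2 * ∑' i, r i) / 4) :
    UniformVariance (F.scheme ℰ γ) (ULoop3.polyakov 0 x) c := by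
  refine ⟨hc, Eventually.of_forall fun K => ?_⟩
  rw [expectAt_eq_zero_of_odd_SU2 F ℰ γ K (μ := 0) (Cs := [ULoop3.polyakov 0 x])
    (by rw [List.map_singleton, List.sum_singleton, ULoop3.wind_polyakov]; exact odd_one)]
  have h1 := expectAt_polyakov_pair_ge_mul hE hγ h hr hw hw' hr0 hw0 hw0' hx K
  simp only [ne_eq, OfNat.ofNat_ne_zero, not_false_eq_true, zero_pow, sub_zero, ge_iff_le]
  linarith

/-- Hence `LimitPointsNontrivial (F.scheme ℰ γ)` whenever `Σ(w + w') < e^{−2Σr}/4`. [cite: JaffeWittenClay2006, §4 p.6] -/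
theorem limitPointsNontrivial_of_smallMass (hE : ℰ.MeasurableE) (hγ : 0 ≤ γ) (h : UnitTiltTail F ℰ γ r w w')
    (hr : Summable r) (hw : Summable w) (hw' : Summable w') (hr0 : ∀ K, 0 ≤ r K) (hw0 : ∀ K, 0 ≤ w K) (hw0' : ∀ K, 0 ≤ w' K)
    (hsmall : ∑' i, (w i + w' i) < Real.exp (-2 * ∑' i, r i) / 4) : LimitPointsNontrivial (F.scheme ℰ γ) := by
  have hx : (0 : F.USite) 0 = 0 := rfl
  exact limitPointsNontrivial_of_uniformVariance
    (uniformVariance_polyakov_of_smallMass hE hγ h hr hw hw' hr0 hw0 hw0' hx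
      (c := (Real.exp (-2 * ∑' i, r i) / 4 - ∑' i, (w i + w' i)) / 2) (by linarith) (by linarith))

/-- **THE RUNG'S TARGET PLUS NON-TRIVIALITY, smallness on the masses only**: `ContinuumYM3Torus F ℰ γ ∧ LimitPointsNontrivial (F.scheme ℰ γ)`
under `UnitTiltTail` with summable non-negative rates and `Σ(w + w') < e^{−2Σr}/4`. [cite: JaffeWittenClay2006, §6.5 p.11] -/
theorem continuumYM3Torus_nontrivial_of_smallMass (hE : ℰ.MeasurableE) (hγ : 0 ≤ γ) (h : UnitTiltTail F ℰ γ r w w')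
    (hr : Summable r) (hw : Summable w) (hw' : Summable w') (hr0 : ∀ K, 0 ≤ r K) (hw0 : ∀ K, 0 ≤ w K) (hw0' : ∀ K, 0 ≤ w' K)
    (hsmall : ∑' i, (w i + w' i) < Real.exp (-2 * ∑' i, r i) / 4) :
    ContinuumYM3Torus F ℰ γ ∧ LimitPointsNontrivial (F.scheme ℰ γ) :=
  ⟨continuumYM3Torus_of_unitTiltTail F ℰ hE hγ hr hw hw' h,
    limitPointsNontrivial_of_smallMass hE hγ h hr hw hw' hr0 hw0 hw0' hsmall⟩

end SU2

end Literature.MathematicalPhysics.QuantumFieldTheory.Balaban1983to89.T3TailTransferLower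

end
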